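import Summits.BirchSwinnertonDyer.Rank1Residual.GaloisImage.OrdinaryLineInertiaCyclotomic
import Summits.BirchSwinnertonDyer.Rank1Residual.X2.GreenbergVatsalReductionDatumCard
import Summits.BirchSwinnertonDyer.Rank1Residual.X2.GreenbergVatsalStrictAtP
import Summits.BirchSwinnertonDyer.Rank1Residual.X2.GreenbergVatsalSelmerLink
import Summits.BirchSwinnertonDyer.Rank1Residual.X2.GreenbergVatsalTateDatumCofree
import Literature.NumberTheory.EllipticCurves.Greenberg1999.KummerImageGoodOrdinaryProofs
import Mathlib.RingTheory.RootsOfUnity.AlgebraicallyClosed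
import HarnessLib

/-!
# T-42 in the kernel, LXIII: the LINE PACKAGE of Greenberg's reduction datum `C = ker(E[p^∞] → Ẽ)` at a
# place `v ∋ p` of GOOD ORDINARY reduction of `E/ℚ` (the inputs (d), (i), (s), (iv) of LXII
# `exists_twisted_class_of_kummer_of_linePackage` and of the generic dual Kummer condition)

Cell `bsd-2adic` (run/shared/lean/pub/bsd-2adic/), seat `bsd-2adic-t42` (BRIEF-T42), GEN 29 (memo
`t42/DESIGN-T42-ADDENDUM-33.md`, the «F3a road» of ADDENDUM-32 §A32.5). HONEST FRAMING: research route; THEOREMS ONLY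
(no `def`, no named fact, no instance); nothing booked; nothing re-keyed; BSD is not proved by any of this.
PARTITION: X5@2 GV-transport rows whose REFERENCE curve is GOOD ORDINARY at `2` (K4ᵐ B1·O1; the binder `hF3a` =
`Matsuno2008.lemma45i_noFiniteSubmodule_nonPrimitive_goodOrd_two` of p744459) × p = 2 — types-the-object-of; bears_on
K4 items 19922 / 19923 (`--supports stmt-BirchSwinnertonDyer-19923`).

## What

For a globally minimal `E/ℚ`, a prime `p` with `p ∤ Δ_E` and `p ∤ a_p` (good ORDINARY reduction), the place `v ∋ p`,
and Greenberg's datum `N = reductionDatum W p hv hΔ` of the tree (`C_v = N.plus = ker(E[p^∞] → Ẽ(k̄_v))`, Greenberg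
LNM 1716 §2 p. 70; Greenberg–Vatsal p. 14), ANY prime `p`:

* (d) `reductionDatum_plus_divisible` — `C_v` is `p`-divisible (the ordinary filtration `localRed_ordinary_filtration`:
  `ker red_v` is `p`-divisible in `E(ℚ̄_v)`, and torsion is algebraic);
* (i) `exists_kummerPoint_of_cocycle_mem_reductionDatum_plus` — for the cyclotomic `κ`, every continuous `C_v`-valued
  crossed homomorphism of `G_K = (ker κ)_v` (`K = ℚ_{∞,𝔭}`) into `E[p^∞]` is a Kummer coboundary `τ ↦ τQ − Q`,
  `Q ∈ E(ℚ̄_v)` — Greenberg's Prop. 2.4 «`Im(λ_K) ⊆ Im(κ_K)`» in LOCAL cochain form, from the Coates–Greenberg record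
  `H¹(K_∞K_v, Ê(𝔪̄)) = 0` (`CoatesGreenberg1996.H1_goodModelKernel_trivial_holds`, a tree theorem);
* (s) `localKerOver_le_strictKer_reductionDatum` — over `ℚ_∞`, KUMMER classes at `v` are STRICT:
  `W.localKerOver p (ker κ) ℚ_v ≤ N.strictKer (ker κ)` (tree: `localKerOver_le_greenbergKer` with the Kummer
  compatibility `reductionDatum_kummer`, then `greenbergKer_le_strictKer` — GV p. 26 / LNM 1716 Prop. 2.2);
* (iv) `reductionDatum_inertia_smul_eq` — every `σ ∈ I_{ℚ_v}` acting on `μ_{p^n}(ℚ̄_v)` as `ζ ↦ ζ^a` acts on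
  `C_v ∩ E[p^∞][p^n]` as `c ↦ a•c`: inertia acts on the ordinary line through the cyclotomic character (tree
  `OrdinaryLineInertiaCyclotomic.exists_generator_inertia_smul_eq_cyclotomicCharacter`, Weil pairing + inertia trivial
  on `Ẽ`; Greenberg p. 70 «the action on `ℱ[p^∞]` is `φψ⁻¹`»), compared with `a` on a primitive `p^n`-th root of unity.

Together with the tree's `natCard_reductionDatum_plus_inf_torsionBy` (`#C_v[p] = p`) these are the five inputs of the
reduction-type-generic twisted descent at `v` (file LXII) — the good-ordinary twin of file XXXVII's Tate-line package.

References: [GreenbergLNM1716] §1 p. 62, §2 Props. 2.2, 2.4 (pp. 70–76), §4 p. 124; [GreenbergVatsal2000] §2 pp. 14, 16, 26;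
[CoatesGreenberg1996] Cor. 3.2, Prop. 4.3; [SilvermanAEC2009] III.8.1, VII.2.1; [SerreGaloisCohomology1997] I §2.
-/

set_option autoImplicit false
set_option linter.dupNamespace false

noncomputable section

open scoped Classical AddSubgroup NNReal

namespace Summit.BirchSwinnertonDyer.BirchSwinnertonDyer.Theorems.MultTransportTwistedDescent

open NumberField IsDedekindDomain Field WeierstrassCurve
  Literature.NumberTheory.GaloisRepresentations Literature.NumberTheory.EllipticCurves
  Literature.NumberTheory.EllipticCurves.GreenbergSelmer IsDedekindDomain.HeightOneSpectrum
  Summit.BirchSwinnertonDyer.Rank1Residual.X2.GreenbergVatsalReductionDatum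
  Summit.BirchSwinnertonDyer.Rank1Residual.X2
  Summit.BirchSwinnertonDyer.Rank1Residual.GaloisImage.OrdinaryLineInertiaCyclotomic
open WeierstrassCurve (minimalDiscriminantInt integralModelInt)

variable (W : WeierstrassCurve ℚ) [W.IsGloballyMinimal] [W.IsElliptic] (p : ℕ) [hp : Fact p.Prime]
  {v : HeightOneSpectrum (𝓞 ℚ)}

/-! ## §0 The ordinary filtration on `ker red_v` (tree, repackaged) -/

/-- **The ordinary filtration of `ker red_v ⊆ E(ℚ̄_v)` at a good ordinary `v ∋ p`** (tree
`localRed_ordinary_filtration` at the tree's reduction map `localRed`): `(ker red_v)[p^r]` is cyclic of order `p^r` on a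
generator, and `ker red_v` is `p`-divisible. [cite: GreenbergLNM1716, §1 p. 62] [cite: SilvermanAEC2009, Prop. VII.2.1] -/
theorem localRed_filtration (hpv : ((p : ℕ) : 𝓞 ℚ) ∈ v.asIdeal)
    (hΔ : ¬ (p : ℤ) ∣ minimalDiscriminantInt W) (hord : ¬ (p : ℤ) ∣ W.frobeniusTrace p) :
    (∀ r : ℕ, ∃ P₁ : localPoints W (v.adicCompletion ℚ), localRed W p hpv hΔ P₁ = 0 ∧ addOrderOf P₁ = p ^ r ∧
      ∀ P : localPoints W (v.adicCompletion ℚ), localRed W p hpv hΔ P = 0 → ((p ^ r : ℕ) : ℤ) • P = 0 →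
        ∃ c : ℕ, P = c • P₁) ∧
    (∀ a : localPoints W (v.adicCompletion ℚ), localRed W p hpv hΔ a = 0 →
      ∃ b : localPoints W (v.adicCompletion ℚ), localRed W p hpv hΔ b = 0 ∧ p • b = a) := by
  have hΔu := W.isUnit_Δ_localIntModel hpv (specVal_spec v) hΔ
  have hvO : (specVal v).Integers (specVal v).valuationSubring :=
    Valuation.valuationSubring.integers (specVal v)
  have hpO : specVal v ((p : ℕ) : AlgebraicClosure (v.adicCompletion ℚ)) < 1 := by
    have h := spectralValuation_algebraMap_ringOfIntegers_lt_one (v := v) (specVal_spec v) hpv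
    rwa [map_natCast] at h
  haveI hchar : CharP (IsLocalRing.ResidueField ↥(specVal v).valuationSubring) p := by
    refine (CharP.charP_iff_prime_eq_zero hp.out).mpr ?_
    rw [← map_natCast (IsLocalRing.residue ↥(specVal v).valuationSubring),
      IsLocalRing.residue_eq_zero_iff, IsLocalRing.mem_maximalIdeal, mem_nonunits_iff,
      hvO.isUnit_iff_valuation_eq_one]
    exact fun h ↦ absurd h (ne_of_lt (by simpa using hpO))
  have hordA := W.exists_zsmul_eq_zero_localRed_ne_zero (specVal_spec v) hΔu (localRed W p hpv hΔ)
    (fun _ ↦ rfl) hpv hΔ hord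
  obtain ⟨hgenr, -, hdivr⟩ := W.localRed_ordinary_filtration hΔu (localRed W p hpv hΔ) (fun _ ↦ rfl) hordA
  exact ⟨hgenr, hdivr⟩

/-! ## §1 (d) `C_v` is `p`-divisible -/

/-- **(d) `C_v = ker(E[p^∞] → Ẽ(k̄_v))` is `p`-divisible** at a good ordinary `v ∋ p` (Greenberg's `ℱ[p^∞] ≅ ℚ_p/ℤ_p`,
LNM 1716 §1 p. 62, §2 p. 70): for `c ∈ C_v`, `ι c = p b` with `b ∈ ker red_v` (`localRed_filtration`), `b` is
`p`-power torsion, hence `b = ι c'` with `c' ∈ E[p^∞]` (torsion is algebraic), `c' ∈ C_v` and `p c' = c` (`ι` injective).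
[cite: GreenbergLNM1716, §1 p. 62 and §2 p. 70] [cite: GreenbergVatsal2000, §2 p. 14] -/
theorem reductionDatum_plus_divisible (hpv : ((p : ℕ) : 𝓞 ℚ) ∈ v.asIdeal)
    (hΔ : ¬ (p : ℤ) ∣ minimalDiscriminantInt W) (hord : ¬ (p : ℤ) ∣ W.frobeniusTrace p) :
    ∀ c ∈ (reductionDatum W p hpv hΔ).plus, ∃ c' ∈ (reductionDatum W p hpv hΔ).plus, p • c' = c := by
  intro c hc
  obtain ⟨-, hdivK⟩ := localRed_filtration W p hpv hΔ hord
  rw [mem_reductionDatum_plus_iff] at hc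
  obtain ⟨b, hbred, hbc⟩ := hdivK _ hc
  -- `b` is `p`-power torsion
  obtain ⟨k, hk⟩ := c.2
  have hb : p ^ (k + 1) • b = 0 := by
    rw [pow_succ, mul_nsmul', hbc, ← map_nsmul, ← AddSubmonoidClass.coe_nsmul]
    have hk' : (p ^ k • c : W.geomPrimaryTorsion p) = 0 := Subtype.ext hk
    rw [hk', ZeroMemClass.coe_zero, map_zero]
  obtain ⟨m, hm⟩ := GreenbergVatsalTateDatumCofree.exists_primaryTorsion_pointsMap_eq W p b (k + 1) hb
  refine ⟨m, ?_, ?_⟩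
  · rw [mem_reductionDatum_plus_iff, hm]; exact hbred
  · apply GreenbergVatsalTateDatumCofree.pointsMap_coe_injective W p (v := v)
    change pointsMap W (v.adicCompletion ℚ) ((p • m : W.geomPrimaryTorsion p) : W.geomPoints) =
      pointsMap W (v.adicCompletion ℚ) (c : W.geomPoints)
    rw [AddSubmonoidClass.coe_nsmul, map_nsmul, hm, hbc]

/-! ## §2 (i) `C_v`-valued cocycles of `G_K = (ker κ)_v` are Kummer coboundaries (Coates–Greenberg) -/

/-- **(i) Greenberg's Prop. 2.4 «`Im(λ_K) ⊆ Im(κ_K)`» at `K = ℚ_{∞,𝔭}`, LOCAL cochain form, good ordinary `v ∋ p`**: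
every continuous crossed homomorphism `f : G_K → E[p^∞]` (`G_K = (ker κ)_v`, `κ` cyclotomic) with values in
`C_v = ker(E[p^∞] → Ẽ)` is a Kummer coboundary, `ι(f τ) = τQ − Q` with `Q ∈ E(ℚ̄_v)`. Proof: `ι ∘ f` is a continuous
cocycle of the closed group `G_K ≤ Γ_{ℚ_v}` with values in the kernel of reduction of the minimal model over the
valuation ring of `|·|_v`, so it is the coboundary of a point of that kernel by the Coates–Greenberg record
`H1_goodModelKernel_trivial_holds` (`H¹(L, Ê(𝔪̄)) = 0` for `L ⊇ K_∞K_v`). [cite: GreenbergLNM1716, §2 Prop. 2.4 (pp. 74–75) and p. 83]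
[cite: CoatesGreenberg1996, Cor. 3.2 and Prop. 4.3] -/
theorem exists_kummerPoint_of_cocycle_mem_reductionDatum_plus (κ : ZpExtension ℚ p) (hκ : κ.IsCyclotomic)
    (hpv : ((p : ℕ) : 𝓞 ℚ) ∈ v.asIdeal) (hΔ : ¬ (p : ℤ) ∣ minimalDiscriminantInt W)
    (f : localSubgroup κ.kerSubgroup (v.adicCompletion ℚ) → W.geomPrimaryTorsion p)
    (hfC : ∀ τ, f τ ∈ (reductionDatum W p hpv hΔ).plus) (hfcont : Continuous f)
    (hfcoc : ∀ τ₁ τ₂, f (τ₁ * τ₂) = f τ₁ + resGal (K := ℚ) (v.adicCompletion ℚ)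
      (τ₁ : absoluteGaloisGroup (v.adicCompletion ℚ)) • f τ₂) :
    ∃ Q : localPoints W (v.adicCompletion ℚ),
      ∀ τ : localSubgroup κ.kerSubgroup (v.adicCompletion ℚ),
        pointsMap W (v.adicCompletion ℚ) (f τ : W.geomPoints) =
          (τ : absoluteGaloisGroup (v.adicCompletion ℚ)) • Q - Q := by
  -- `ι ∘ f` as a continuous cocycle of `G_K` with values in `E(ℚ̄_v)`
  have hιf : Continuous fun τ : localSubgroup κ.kerSubgroup (v.adicCompletion ℚ) ↦
      pointsMap W (v.adicCompletion ℚ) (f τ : W.geomPoints) :=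
    (continuous_of_discreteTopology (f := fun m : W.geomPrimaryTorsion p ↦
      pointsMap W (v.adicCompletion ℚ) (m : W.geomPoints))).comp hfcont
  let F : contOneCocycles (discreteTopRep (localSubgroup κ.kerSubgroup (v.adicCompletion ℚ))
      (localPoints W (v.adicCompletion ℚ))) :=
    ⟨⟨fun τ ↦ pointsMap W (v.adicCompletion ℚ) (f τ : W.geomPoints), hιf⟩, fun τ₁ τ₂ ↦ by
      change pointsMap W (v.adicCompletion ℚ) (f (τ₁ * τ₂) : W.geomPoints) =
        pointsMap W (v.adicCompletion ℚ) (f τ₁ : W.geomPoints) +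
          (τ₁ : absoluteGaloisGroup (v.adicCompletion ℚ)) • pointsMap W (v.adicCompletion ℚ) (f τ₂ : W.geomPoints)
      rw [hfcoc, AddSubgroup.coe_add, map_add, primaryComponent.coe_smul, pointsMap_smul]⟩
  have hFapply : ∀ τ, F.1 τ = pointsMap W (v.adicCompletion ℚ) (f τ : W.geomPoints) := fun _ ↦ rfl
  -- the minimal model over the valuation ring of `|·|_v` and its reduction map
  have hw := specVal_spec v
  have hΔu : IsUnit ((integralModelInt W).map (algebraMap ℤ ↥(specVal v).valuationSubring)).Δ :=
    isUnit_Δ_localIntModel W hpv hw hΔ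
  let W₀ : WeierstrassCurve (specVal v).integer := (integralModelInt W).map (algebraMap ℤ ↥(specVal v).valuationSubring)
  have hΔ' : IsUnit W₀.Δ := hΔu
  have e₁ : W₀.baseChange (AlgebraicClosure (v.adicCompletion ℚ)) = W.baseChange (AlgebraicClosure (v.adicCompletion ℚ)) :=
    localIntModel_baseChange W (specVal v).valuationSubring
  have hW₀ : (1 : VariableChange (AlgebraicClosure (v.adicCompletion ℚ))) •
      (W.baseChange (v.adicCompletion ℚ)).baseChange (AlgebraicClosure (v.adicCompletion ℚ)) =
        W₀.baseChange (AlgebraicClosure (v.adicCompletion ℚ)) := by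
    rw [one_smul, baseChange_baseChange_adicCompletion, e₁]
  have hred : ∀ P, localRed W p hpv hΔ P = goodReductionHom W₀ (Valuation.integer.integers (specVal v)) hΔ'
      (Affine.Point.congrEquiv hW₀ (VariableChange.pointEquiv _ 1
        (Affine.Point.congrEquiv (baseChange_baseChange_adicCompletion W v).symm P))) := by
    intro P
    rw [localRed_apply, goodReductionHom_apply]
    congr 1
    change (W.baseChange (AlgebraicClosure (v.adicCompletion ℚ))).toAffine.Point at P
    rcases P with _ | ⟨x, y, hP⟩
    · simp only [← Affine.Point.zero_def, map_zero]
      rfl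
    · simp only [Affine.Point.congrEquiv_some, VariableChange.pointEquiv_some]
      exact point_some_congr (toX_one x).symm (toY_one x y).symm
  -- `F` has values in the kernel of reduction of the good model
  have hkernel : ∀ τ, Affine.Point.congrEquiv hW₀ (VariableChange.pointEquiv _ 1
      (Affine.Point.congrEquiv (baseChange_baseChange_adicCompletion W v).symm (F.1 τ))) ∈
        kernelOfReduction W₀ (Valuation.integer.integers (specVal v)) := by
    intro τ
    rw [hFapply, mem_kernelOfReduction_iff,
      ← goodReductionHom_eq_zero_iff (Valuation.integer.integers (specVal v)) hΔ', ← hred]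
    exact (mem_reductionDatum_plus_iff W p hpv hΔ _).1 (hfC τ)
  -- the local group `G_K = (ker κ)_v`: closed, fixing the change `1`
  have hGc : IsClosed ((localSubgroup κ.kerSubgroup (v.adicCompletion ℚ) :
      Set (absoluteGaloisGroup (v.adicCompletion ℚ)))) :=
    κ.isClosed_kerSubgroup.preimage (map_continuous (resGal (K := ℚ) (v.adicCompletion ℚ)))
  have hGC : ∀ σ ∈ localSubgroup κ.kerSubgroup (v.adicCompletion ℚ),
      (1 : VariableChange (AlgebraicClosure (v.adicCompletion ℚ))).map
        ((absoluteGaloisGroup.toAlgEquiv (v.adicCompletion ℚ) σ :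
          AlgebraicClosure (v.adicCompletion ℚ) ≃ₐ[v.adicCompletion ℚ] AlgebraicClosure (v.adicCompletion ℚ)) :
          AlgebraicClosure (v.adicCompletion ℚ) →+* AlgebraicClosure (v.adicCompletion ℚ)) = 1 :=
    fun σ _ ↦ (VariableChange.mapHom _).map_one
  -- Coates–Greenberg: `F` is the coboundary of a point of the kernel of reduction
  obtain ⟨a, -, hφa⟩ := CoatesGreenberg1996.H1_goodModelKernel_trivial_holds ℚ W p κ hκ v hpv (specVal v) hw 1 W₀
    hW₀ hΔ' (localSubgroup κ.kerSubgroup (v.adicCompletion ℚ)) hGc le_rfl hGC F hkernel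
  exact ⟨a, fun τ ↦ by rw [← hFapply]; exact hφa τ⟩

/-! ## §3 (s) Kummer classes over `ℚ_∞` are STRICT at `v` -/

/-- **(s) KUMMER ⇒ STRICT at the place above a good ordinary `p`, over `ℚ_∞`**: for the cyclotomic `κ`,
`W.localKerOver p (ker κ) ℚ_v ≤ (reductionDatum W p hv hΔ).strictKer (ker κ)` — every class of `H¹(ℚ_∞, E[p^∞])` whose
restriction to `G_K = (ker κ)_v` dies in `H¹(K, E(ℚ̄_v))` dies in `H¹(K, E[p^∞]/C_v) = H¹(K, Ẽ[p^∞])` (Greenberg's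
`Im κ_K ⊆ Im λ_K`, LNM 1716 Prop. 2.2, composed with GV p. 26 «`L_𝔭 =` the strict condition over `ℚ_∞`»: tree
`localKerOver_le_greenbergKer` with the Kummer compatibility `reductionDatum_kummer`, then `greenbergKer_le_strictKer`).
[cite: GreenbergLNM1716, §2 Prop. 2.2 (pp. 73–74)] [cite: GreenbergVatsal2000, §2 pp. 16, 26] -/
theorem localKerOver_le_strictKer_reductionDatum (κ : ZpExtension ℚ p) (hκ : κ.IsCyclotomic)
    (hpv : ((p : ℕ) : 𝓞 ℚ) ∈ v.asIdeal) (hΔ : ¬ (p : ℤ) ∣ minimalDiscriminantInt W)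
    (hord : ¬ (p : ℤ) ∣ W.frobeniusTrace p) :
    W.localKerOver p κ.kerSubgroup (v.adicCompletion ℚ) ≤ (reductionDatum W p hpv hΔ).strictKer κ.kerSubgroup :=
  (GreenbergVatsalSelmerLink.localKerOver_le_greenbergKer W p κ.kerSubgroup (reductionDatum W p hpv hΔ)
    (reductionDatum_kummer W p hpv hΔ)).trans (GreenbergVatsalStrictAtP.greenbergKer_le_strictKer W p κ hκ hpv hΔ hord)

/-! ## §4 (iv) inertia acts on `C_v[p^n]` through the cyclotomic character -/

/-- **(iv) Inertia acts on `C_v ∩ E[p^∞][p^n]` through the cyclotomic character**: if `σ ∈ I_{ℚ_v}` acts on the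
`p^n`-th roots of unity of `ℚ̄_v` as `ζ ↦ ζ^a`, then `σ c = a•c` for every `c ∈ C_v` with `p^n c = 0`. The level-`p^n`
line `(ker red_v)[p^n] = ℤ P` has a generator on which inertia acts by `χ_p(σ) mod p^n` (tree
`exists_generator_inertia_smul_eq_cyclotomicCharacter`: Weil pairing + inertia trivial on `Ẽ`); on a PRIMITIVE
`p^n`-th root of unity `ζ` (which exists in `ℚ̄_v`, characteristic `0`) `σζ = ζ^{χ_p(σ)} = ζ^a`, so
`a ≡ χ_p(σ) (mod p^n)` and `σ P = a P`; finally `ι c = j P`. [cite: GreenbergLNM1716, §2 p. 70]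
[cite: GreenbergVatsal2000, §2 p. 26] [cite: SilvermanAEC2009, Prop. III.8.1] -/
theorem reductionDatum_inertia_smul_eq (hpv : ((p : ℕ) : 𝓞 ℚ) ∈ v.asIdeal)
    (hΔ : ¬ (p : ℤ) ∣ minimalDiscriminantInt W) (hord : ¬ (p : ℤ) ∣ W.frobeniusTrace p)
    {σ : absoluteGaloisGroup (v.adicCompletion ℚ)} (hσ : σ ∈ absInertia (v.adicCompletion ℚ)) (n a : ℕ)
    (hroots : ∀ ζ : (AlgebraicClosure (v.adicCompletion ℚ))ˣ, ζ ^ p ^ n = 1 →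
      Units.map (Field.absoluteGaloisGroup.toAlgEquiv (v.adicCompletion ℚ) σ :
        AlgebraicClosure (v.adicCompletion ℚ) →* AlgebraicClosure (v.adicCompletion ℚ)) ζ = ζ ^ a)
    {c : W.geomPrimaryTorsion p} (hc : c ∈ (reductionDatum W p hpv hΔ).plus) (hcn : p ^ n • c = 0) :
    resGal (K := ℚ) (v.adicCompletion ℚ) σ • c = a • c := by
  obtain ⟨P, hPred, hPord, hPgen, hχ⟩ := exists_generator_inertia_smul_eq_cyclotomicCharacter W p hpv hΔ hord n
  set e : ℕ := ((GaloisRep.cyclotomicCharacter (v.adicCompletion ℚ) p σ).val.toZModPow n).val with he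
  have helt : e < p ^ n := ZMod.val_lt _
  -- a primitive `p^n`-th root of unity in `ℚ̄_v`
  haveI : NeZero ((p : ℕ) : v.adicCompletion ℚ) := ⟨by
    rw [← map_natCast (algebraMap ℚ (v.adicCompletion ℚ))]
    exact (map_ne_zero_iff _ (algebraMap ℚ (v.adicCompletion ℚ)).injective).mpr
      (Nat.cast_ne_zero.mpr hp.out.ne_zero)⟩
  obtain ⟨ζ, hζ⟩ := HasEnoughRootsOfUnity.prim (M := AlgebraicClosure (v.adicCompletion ℚ)) (n := p ^ n)
  -- `σζ = ζ^e` (cyclotomic character) and `σζ = ζ^a` (hypothesis)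
  have hσζe : σ • ζ = ζ ^ e :=
    GaloisRep.cyclotomicCharacter_spec (v.adicCompletion ℚ) p σ ζ hζ.pow_eq_one
  have hζu : IsUnit ζ := hζ.isUnit (pow_ne_zero n hp.out.ne_zero)
  have hσζa : σ • ζ = ζ ^ a := by
    have h1 : hζu.unit ^ p ^ n = 1 := Units.ext (by rw [Units.val_pow_eq_pow_val, IsUnit.unit_spec, hζ.pow_eq_one, Units.val_one])
    have h2 := congrArg Units.val (hroots hζu.unit h1)
    rw [Units.coe_map, MonoidHom.coe_coe, IsUnit.unit_spec, Units.val_pow_eq_pow_val, IsUnit.unit_spec] at h2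
    rw [Field.absoluteGaloisGroup.smul_def]
    exact h2
  have hmod : a % p ^ n = e := by
    have hcmp : ζ ^ (a % p ^ n) = ζ ^ e := by
      rw [← hσζe, hσζa, hζ.eq_orderOf, pow_mod_orderOf]
    exact hζ.pow_inj (Nat.mod_lt _ (pow_pos hp.out.pos n)) helt hcmp
  -- hence `σ P = a P`
  have hσP : σ • P = a • P := by
    rw [hχ σ hσ, ← he, ← hmod, ← hPord, mod_addOrderOf_nsmul]
  -- `ι c = j P`
  have hιred : localRed W p hpv hΔ (pointsMap W (v.adicCompletion ℚ) (c : W.geomPoints)) = 0 :=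
    (mem_reductionDatum_plus_iff W p hpv hΔ c).1 hc
  have hιtor : ((p ^ n : ℕ) : ℤ) • pointsMap W (v.adicCompletion ℚ) (c : W.geomPoints) = 0 := by
    rw [natCast_zsmul, ← map_nsmul, ← AddSubmonoidClass.coe_nsmul]
    have h0 : (p ^ n • c : W.geomPrimaryTorsion p) = 0 := hcn
    rw [h0, ZeroMemClass.coe_zero, map_zero]
  obtain ⟨j, hj⟩ := hPgen _ hιred hιtor
  apply GreenbergVatsalTateDatumCofree.pointsMap_coe_injective W p (v := v)
  change pointsMap W (v.adicCompletion ℚ) ((resGal (K := ℚ) (v.adicCompletion ℚ) σ • c : W.geomPrimaryTorsion p) :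
      W.geomPoints) = pointsMap W (v.adicCompletion ℚ) ((a • c : W.geomPrimaryTorsion p) : W.geomPoints)
  rw [primaryComponent.coe_smul, pointsMap_smul, AddSubmonoidClass.coe_nsmul, map_nsmul, hj, smul_comm σ j P, hσP,
    smul_comm j a P]

/-! ## §5 The package -/

/-- **The ordinary LINE PACKAGE at `v ∋ p`** (good-ordinary twin of file XXXVII's Tate-line package; the five inputs
(d), (c), (i), (s), (iv) of LXII `exists_twisted_class_of_kummer_of_linePackage` for `N = reductionDatum W p hv hΔ`), for
a globally minimal `E/ℚ` with `p ∤ Δ_E`, `p ∤ a_p` and the cyclotomic `ℤ_p`-extension `κ`.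
[cite: GreenbergLNM1716, §1 p. 62, §2 Props. 2.2, 2.4 (pp. 70–76)] [cite: GreenbergVatsal2000, §2 pp. 14, 16, 26]
[cite: CoatesGreenberg1996, Cor. 3.2 and Prop. 4.3] -/
theorem reductionDatum_linePackage (κ : ZpExtension ℚ p) (hκ : κ.IsCyclotomic)
    (hpv : ((p : ℕ) : 𝓞 ℚ) ∈ v.asIdeal) (hΔ : ¬ (p : ℤ) ∣ minimalDiscriminantInt W)
    (hord : ¬ (p : ℤ) ∣ W.frobeniusTrace p) :
    (∀ c ∈ (reductionDatum W p hpv hΔ).plus, ∃ c' ∈ (reductionDatum W p hpv hΔ).plus, p • c' = c) ∧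
    Nat.card ↥((reductionDatum W p hpv hΔ).plus ⊓ (↥(W.geomPrimaryTorsion p))[(p : ℤ)]) = p ∧
    (∀ (f : localSubgroup κ.kerSubgroup (v.adicCompletion ℚ) → W.geomPrimaryTorsion p),
      (∀ τ, f τ ∈ (reductionDatum W p hpv hΔ).plus) → Continuous f →
      (∀ τ₁ τ₂, f (τ₁ * τ₂) = f τ₁ + resGal (K := ℚ) (v.adicCompletion ℚ)
        (τ₁ : absoluteGaloisGroup (v.adicCompletion ℚ)) • f τ₂) →
      ∃ Q : localPoints W (v.adicCompletion ℚ),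
        ∀ τ : localSubgroup κ.kerSubgroup (v.adicCompletion ℚ),
          pointsMap W (v.adicCompletion ℚ) (f τ : W.geomPoints) =
            (τ : absoluteGaloisGroup (v.adicCompletion ℚ)) • Q - Q) ∧
    W.localKerOver p κ.kerSubgroup (v.adicCompletion ℚ) ≤ (reductionDatum W p hpv hΔ).strictKer κ.kerSubgroup ∧
    (∀ σ ∈ absInertia (v.adicCompletion ℚ), ∀ (n a : ℕ),
      (∀ ζ : (AlgebraicClosure (v.adicCompletion ℚ))ˣ, ζ ^ p ^ n = 1 →
        Units.map (Field.absoluteGaloisGroup.toAlgEquiv (v.adicCompletion ℚ) σ :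
          AlgebraicClosure (v.adicCompletion ℚ) →* AlgebraicClosure (v.adicCompletion ℚ)) ζ = ζ ^ a) →
      ∀ c ∈ (reductionDatum W p hpv hΔ).plus, p ^ n • c = 0 →
        resGal (K := ℚ) (v.adicCompletion ℚ) σ • c = a • c) :=
  ⟨reductionDatum_plus_divisible W p hpv hΔ hord,
    GreenbergVatsalReductionDatum.natCard_reductionDatum_plus_inf_torsionBy W p hpv hΔ hord,
    exists_kummerPoint_of_cocycle_mem_reductionDatum_plus W p κ hκ hpv hΔ,
    localKerOver_le_strictKer_reductionDatum W p κ hκ hpv hΔ hord,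
    fun _ hσ n a hroots _ hc hcn ↦ reductionDatum_inertia_smul_eq W p hpv hΔ hord hσ n a hroots hc hcn⟩

end Summit.BirchSwinnertonDyer.BirchSwinnertonDyer.Theorems.MultTransportTwistedDescent

end
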